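import Summits.KontsevichZagierPeriods.KontsevichZagierPeriods.Theorems.HermiteRigidityDilogRigidityCubeTwoSeries
import Mathlib.MeasureTheory.Integral.Pi
import Mathlib.MeasureTheory.Integral.DominatedConvergence
import Mathlib.Analysis.SpecificLimits.Basic
import Mathlib.Analysis.SpecialFunctions.Integrals.Basic

/-!
# `ReductionRigidity` (stmt-KontsevichZagierPeriods-3407), line `Sketch` (growth programme
# `DilogRigidity`, wave 2): stub `stub_cubeTwoIntegralSeriesLevel`

THE VALUE OF THE WEIGHT-TWO NORMAL FORM AS A SERIES, AT A REAL LEVEL. For a real `ν ≥ 2`,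

  `∫_{[0,1]²} dx dy / (ν − x y) = ∑_{k ≥ 0} ν^{-(k+1)} / (k+1)² = Li₂(1/ν)`.

This is the real-level generalisation of `stub_cubeTwoIntegralSeries` (integer level `N ≥ 2`,
`HermiteRigidityDilogRigidityCubeTwoSeries.lean`), needed at the rational levels `ν = N/M` of the
weight-two Padé box islands; the rational-level corollary `integral_cube_two_one_div_level_rat`
rewrites `1/(N/M)` as `M/N`.

Proof (termwise integration of the geometric expansion, verbatim from the integer level):
* on the cube `u = x y ∈ [0, 1]` and `ν ≥ 2`, so `0 ≤ u/ν < 1` and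
  `1/(ν − u) = (1/ν) · 1/(1 − u/ν) = ∑_k (1/ν)^{k+1} u^k` (`hasSum_geometric_of_lt_one`);
* `∫` and `∑` are swapped by `MeasureTheory.integral_tsum_of_summable_integral_norm`: each term is
  continuous on the compact cube, nonnegative there, and its integral is `(1/ν)^{k+1}/(k+1)²`, a
  summable sequence (dominated by the geometric series `∑ (1/ν)^{k+1}`);
* termwise, `∫_{[0,1]²} (x y)^k = 1/(k+1)²` is the landed `integral_cube_two_mul_pow`.
-/

noncomputable section

open MeasureTheory Set

namespace Summit.KontsevichZagierPeriods.HermiteRigidity.ReductionRigidity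

open Literature.NumberTheory.Transcendental
open Literature.NumberTheory.Transcendental.KZ

/-! ## The series `∫_{[0,1]²} dx dy/(ν − x y) = ∑_k ν^{-(k+1)}/(k+1)²` for real `ν ≥ 2` -/

/-- **The weight-two normal form as a dilogarithm series, real level**: for a real `ν ≥ 2`,
`∫_{[0,1]²} dx dy/(ν − x y) = ∑_{k ≥ 0} (1/ν)^{k+1}/(k+1)² (= Li₂(1/ν))`, by termwise integration
of the geometric expansion `1/(ν − x y) = ∑_k (x y)^k/ν^{k+1}` (absolutely convergent on the closed
square since `0 ≤ x y/ν ≤ 1/2`). [folklore] -/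
theorem stub_cubeTwoIntegralSeriesLevel : ∀ (ν : ℝ), 2 ≤ ν →
    ∫ p in cube 2, 1 / (ν - p 0 * p 1) = ∑' k : ℕ, (1 / ν) ^ (k + 1) / ((k : ℝ) + 1) ^ 2 := by
  intro ν hν
  have hνpos : (0 : ℝ) < ν := by linarith
  -- the terms of the expansion
  set F : ℕ → (Fin 2 → ℝ) → ℝ := fun k p => (1 / ν) ^ (k + 1) * (p 0 * p 1) ^ k with hF
  -- bounds on `u = x y` on the cube
  have hu : ∀ p ∈ cube 2, 0 ≤ p 0 * p 1 ∧ p 0 * p 1 ≤ 1 := fun p hp =>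
    ⟨mul_nonneg (hp 0).1 (hp 1).1, mul_le_one₀ (hp 0).2 (hp 1).1 (hp 1).2⟩
  -- pointwise geometric expansion on the cube
  have hexp : EqOn (fun p : Fin 2 → ℝ => 1 / (ν - p 0 * p 1)) (fun p => ∑' k, F k p)
      (cube 2) := by
    intro p hp
    obtain ⟨h0, h1⟩ := hu p hp
    have hr0 : 0 ≤ p 0 * p 1 / ν := div_nonneg h0 hνpos.le
    have hr1 : p 0 * p 1 / ν < 1 := by
      rw [div_lt_one hνpos]; linarith
    have hgeom := (hasSum_geometric_of_lt_one hr0 hr1).mul_left (1 / ν)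
    have hval : 1 / ν * (1 - p 0 * p 1 / ν)⁻¹ = 1 / (ν - p 0 * p 1) := by
      have hne : ν - p 0 * p 1 ≠ 0 := by linarith
      field_simp
    have hterm : (fun k : ℕ => 1 / ν * (p 0 * p 1 / ν) ^ k) = fun k => F k p := by
      funext k
      simp only [hF]
      ring
    rw [hval, hterm] at hgeom
    exact hgeom.tsum_eq.symm
  -- each term is integrable on the cube
  have hint : ∀ k, Integrable (F k) (volume.restrict (cube 2)) := by
    intro k
    have hc : Continuous (F k) := by
      simp only [hF]
      fun_prop
    exact hc.continuousOn.integrableOn_compact isCompact_cube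
  -- the value of each termwise integral
  have hval : ∀ k, ∫ p in cube 2, F k p = (1 / ν) ^ (k + 1) / ((k : ℝ) + 1) ^ 2 := by
    intro k
    simp only [hF]
    rw [integral_const_mul, integral_cube_two_mul_pow, mul_one_div]
  -- the norms: `‖F k p‖ = F k p` on the cube
  have hnorm : ∀ k, ∫ p in cube 2, ‖F k p‖ = (1 / ν) ^ (k + 1) / ((k : ℝ) + 1) ^ 2 := by
    intro k
    rw [← hval k]
    refine setIntegral_congr_fun measurableSet_cube fun p hp => ?_
    simp only [hF]
    exact Real.norm_of_nonneg
      (mul_nonneg (pow_nonneg (by positivity) _) (pow_nonneg (hu p hp).1 _))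
  -- summability of the norms: dominated by the geometric series `∑ (1/ν)^(k+1)`
  have hsum : Summable fun k => ∫ p in cube 2, ‖F k p‖ := by
    simp_rw [hnorm]
    have hq0 : 0 ≤ 1 / ν := by positivity
    have hq1 : 1 / ν < 1 := by rw [div_lt_one hνpos]; linarith
    have hg : Summable fun k : ℕ => 1 / ν * (1 / ν) ^ k :=
      (summable_geometric_of_lt_one hq0 hq1).mul_left _
    refine Summable.of_nonneg_of_le (fun k => by positivity) (fun k => ?_) hg
    rw [← pow_succ', div_le_iff₀ (by positivity)]
    have hk : (1 : ℝ) ≤ ((k : ℝ) + 1) ^ 2 := by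
      nlinarith [(k.cast_nonneg : (0 : ℝ) ≤ k)]
    nlinarith [pow_nonneg hq0 (k + 1)]
  -- termwise integration
  rw [setIntegral_congr_fun measurableSet_cube hexp,
    ← integral_tsum_of_summable_integral_norm hint hsum]
  exact tsum_congr hval

/-! ## The rational level `ν = N/M` -/

/-- **Rational-level corollary**: for naturals `1 ≤ M`, `2 M ≤ N`,
`∫_{[0,1]²} dx dy/(N/M − x y) = ∑_{k ≥ 0} (M/N)^{k+1}/(k+1)²`, i.e. the real-level series
`stub_cubeTwoIntegralSeriesLevel` at `ν = N/M ≥ 2` with `1/(N/M) = M/N`. [folklore] -/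
theorem integral_cube_two_one_div_level_rat {M N : ℕ} (hM : 1 ≤ M) (hMN : 2 * M ≤ N) :
    ∫ p in cube 2, 1 / ((N : ℝ) / (M : ℝ) - p 0 * p 1) =
      ∑' k : ℕ, ((M : ℝ) / N) ^ (k + 1) / ((k : ℝ) + 1) ^ 2 := by
  have hMpos : (0 : ℝ) < (M : ℝ) := by exact_mod_cast hM
  have hMN' : (2 : ℝ) * (M : ℝ) ≤ (N : ℝ) := by exact_mod_cast hMN
  have hν : (2 : ℝ) ≤ (N : ℝ) / (M : ℝ) := by
    rw [le_div_iff₀ hMpos]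
    exact hMN'
  rw [stub_cubeTwoIntegralSeriesLevel _ hν, one_div_div]

end Summit.KontsevichZagierPeriods.HermiteRigidity.ReductionRigidity
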